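import Mathlib

/-!
# Route `ParabolicTrajectory` — item `ParabolicCentreCurve` (stmt-QuantumFields-9175): chart estimates

Support file (pointwise estimates) for the abstract Banach-space dynamics item
`Summit.QuantumFields.YangMills.Theses.ParabolicTrajectory.ParabolicCentreCurve`:
a map `F(g, y) = (φ g y, Ψ g y)` on `ℝ × E` with `φ g y = g + b g³ + O(g⁴ + g³‖y‖)`,
`Ψ g y = A y + O(g² + ‖y‖²)`, `‖A‖ ≤ θ < 1`, and the Lipschitz remainder block of the route decl.

Everything here is elementary bookkeeping on the chart `[0, δ₁] × B̄_{δ₁}` (`δ₁ ≤ δ` small), used by the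
graph-transform construction (`…ParabolicCentreCurveGraph`) and the closing file:

* `base_step_bounds` — the base coordinate moves forward: `0 ≤ φ x y − x ≤ 2 b x³`;
* `fibre_bound` — `Ψ` preserves the parabolic wedge `‖y‖ ≤ C' x²` when `(1 − θ) C' = 2C`;
* `base_lipschitz`, `fibre_lipschitz` — joint Lipschitz bounds of `φ − id` and `Ψ` on the chart;
* `strictMonoOn_base` — along an `L`-Lipschitz graph the base map `g ↦ φ g (h g)` is strictly increasing;
* `step_contract` — one step contracts the distance to a forward-invariant Lipschitz graph by
  `θ₁ = θ + 3Cδ₁ + Cδ₁³`;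
* `continuousOn_base` — `t ↦ φ t (h' t)` is continuous along a continuous graph (for the IVT);
* `exists_delta1`, `consts_ineq` — the choice of the small radius and the constant bookkeeping.

Source of the scheme: the Lipschitz graph transform for dominated splittings (Hirsch–Pugh–Shub 1977 §5;
Baldomá–Fontich–de la Llave–Martín 2007 for the parabolic case); here fully elementary.
-/

open Set Filter Topology

namespace Summit.QuantumFields.YangMills.Theorems.ParabolicCentreCurve

variable {E : Type} [NormedAddCommGroup E] [NormedSpace ℝ E]
  {φ : ℝ → E → ℝ} {Ψ : ℝ → E → E} {A : E →L[ℝ] E} {b θ C δ : ℝ}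

/-! ### Elementary real inequalities -/

/-- `|x³ − x'³| ≤ 3 δ₁² |x − x'|` on `[0, δ₁]`. [folklore] -/
theorem abs_cube_sub_cube_le {x x' δ₁ : ℝ} (hx0 : 0 ≤ x) (hx : x ≤ δ₁) (hx0' : 0 ≤ x')
    (hx' : x' ≤ δ₁) : |x ^ 3 - x' ^ 3| ≤ 3 * δ₁ ^ 2 * |x - x'| := by
  have e : x ^ 3 - x' ^ 3 = (x ^ 2 + x * x' + x' ^ 2) * (x - x') := by ring
  rw [e, abs_mul, abs_of_nonneg (by positivity)]
  apply mul_le_mul_of_nonneg_right _ (abs_nonneg _)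
  nlinarith [mul_le_mul hx hx hx0 (hx0.trans hx), mul_le_mul hx hx' hx0' (hx0.trans hx),
    mul_le_mul hx' hx' hx0' (hx0'.trans hx')]

omit [NormedSpace ℝ E] in
/-- The remainder factor of the base-Lipschitz hypothesis is `≤ 2 C δ₁³` on the chart. [folklore] -/
theorem base_factor_le {g g' δ₁ : ℝ} {y : E} (hC : 0 ≤ C) (hg0 : 0 ≤ g) (hg : g ≤ δ₁)
    (hg0' : 0 ≤ g') (hg' : g' ≤ δ₁) (hy : ‖y‖ ≤ δ₁) :
    C * (max |g| |g'|) ^ 2 * (max |g| |g'| + ‖y‖) ≤ 2 * C * δ₁ ^ 3 := by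
  have hm0 : 0 ≤ max |g| |g'| := (abs_nonneg g).trans (le_max_left _ _)
  have hm : max |g| |g'| ≤ δ₁ :=
    max_le (by rwa [abs_of_nonneg hg0]) (by rwa [abs_of_nonneg hg0'])
  calc C * (max |g| |g'|) ^ 2 * (max |g| |g'| + ‖y‖) ≤ C * δ₁ ^ 2 * (δ₁ + δ₁) := by
        apply mul_le_mul _ (add_le_add hm hy) (by positivity) (by positivity)
        exact mul_le_mul_of_nonneg_left (pow_le_pow_left₀ hm0 hm 2) hC
    _ = 2 * C * δ₁ ^ 3 := by ring

/-! ### The hypothesis block as section variables -/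

variable
  (H1 : ∀ g : ℝ, ∀ y : E, |g| ≤ δ → ‖y‖ ≤ δ →
    |φ g y - (g + b * g ^ 3)| ≤ C * (g ^ 4 + |g| ^ 3 * ‖y‖) ∧ ‖Ψ g y - A y‖ ≤ C * (g ^ 2 + ‖y‖ ^ 2))
  (H2 : ∀ g : ℝ, ∀ y y' : E, |g| ≤ δ → ‖y‖ ≤ δ → ‖y'‖ ≤ δ →
    |φ g y - φ g y'| ≤ C * |g| ^ 3 * ‖y - y'‖ ∧
      ‖Ψ g y - Ψ g y' - A (y - y')‖ ≤ C * (|g| + ‖y‖ + ‖y'‖) * ‖y - y'‖)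
  (H3 : ∀ g g' : ℝ, ∀ y : E, |g| ≤ δ → |g'| ≤ δ → ‖y‖ ≤ δ →
    |φ g y - φ g' y - (g - g') - b * (g ^ 3 - g' ^ 3)| ≤
        C * (max |g| |g'|) ^ 2 * (max |g| |g'| + ‖y‖) * |g - g'| ∧
      ‖Ψ g y - Ψ g' y‖ ≤ C * (|g| + |g'| + ‖y‖) * |g - g'|)

/-! ### Pointwise consequences on the chart `[0, δ₁] × B̄_{δ₁}` -/

include H1 in
/-- On the chart the base coordinate moves forward by `φ x y − x ∈ [0, 2 b x³]`
(remainder absorbed by `2 C δ₁ ≤ b`). [folklore] -/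
theorem base_step_bounds (hC : 0 < C) {δ₁ x : ℝ} {y : E} (hδ₁δ : δ₁ ≤ δ) (hK2 : 2 * C * δ₁ ≤ b)
    (hx0 : 0 ≤ x) (hx : x ≤ δ₁) (hy : ‖y‖ ≤ δ₁) :
    0 ≤ φ x y - x ∧ φ x y - x ≤ 2 * b * x ^ 3 := by
  have hxδ : |x| ≤ δ := by rw [abs_of_nonneg hx0]; exact hx.trans hδ₁δ
  have h1 := (H1 x y hxδ (hy.trans hδ₁δ)).1
  rw [abs_of_nonneg hx0] at h1
  have hx3 : 0 ≤ x ^ 3 := pow_nonneg hx0 3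
  have key : C * (x ^ 4 + x ^ 3 * ‖y‖) ≤ b * x ^ 3 := by
    have h4 : x ^ 4 ≤ δ₁ * x ^ 3 := by
      have : x ^ 4 = x * x ^ 3 := by ring
      rw [this]; exact mul_le_mul_of_nonneg_right hx hx3
    have h5 : x ^ 3 * ‖y‖ ≤ δ₁ * x ^ 3 := by
      rw [mul_comm]; exact mul_le_mul_of_nonneg_right hy hx3
    calc C * (x ^ 4 + x ^ 3 * ‖y‖) ≤ C * (δ₁ * x ^ 3 + δ₁ * x ^ 3) :=
          mul_le_mul_of_nonneg_left (add_le_add h4 h5) hC.le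
      _ = (2 * C * δ₁) * x ^ 3 := by ring
      _ ≤ b * x ^ 3 := mul_le_mul_of_nonneg_right hK2 hx3
  obtain ⟨h1l, h1u⟩ := abs_le.1 h1
  constructor <;> nlinarith

include H1 in
/-- The parabolic wedge `‖y‖ ≤ C' x²` is mapped into itself by the fibre map when
`(1 − θ) C' = 2 C` and `C' δ₁ ≤ 1`. [folklore] -/
theorem fibre_bound (hθ : 0 ≤ θ) (hC : 0 < C) (hA : ‖A‖ ≤ θ) {δ₁ C' x : ℝ} {y : E}
    (hδ₁δ : δ₁ ≤ δ) (hC' : (1 - θ) * C' = 2 * C) (hC'0 : 0 ≤ C') (hC'δ₁ : C' * δ₁ ≤ 1)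
    (hx0 : 0 ≤ x) (hx : x ≤ δ₁) (hy : ‖y‖ ≤ C' * x ^ 2) :
    ‖Ψ x y‖ ≤ C' * x ^ 2 := by
  have hC'x : C' * x ≤ 1 := (mul_le_mul_of_nonneg_left hx hC'0).trans hC'δ₁
  have hyx : ‖y‖ ≤ x := by
    calc ‖y‖ ≤ C' * x ^ 2 := hy
      _ = C' * x * x := by ring
      _ ≤ 1 * x := mul_le_mul_of_nonneg_right hC'x hx0
      _ = x := one_mul x
  have hxδ : |x| ≤ δ := by rw [abs_of_nonneg hx0]; exact hx.trans hδ₁δ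
  have hyδ : ‖y‖ ≤ δ := hyx.trans (hx.trans hδ₁δ)
  have h1 := (H1 x y hxδ hyδ).2
  have hAy : ‖A y‖ ≤ θ * (C' * x ^ 2) :=
    (A.le_opNorm y).trans (mul_le_mul hA hy (norm_nonneg _) hθ)
  have hy2 : ‖y‖ ^ 2 ≤ x ^ 2 := pow_le_pow_left₀ (norm_nonneg _) hyx 2
  calc ‖Ψ x y‖ = ‖(Ψ x y - A y) + A y‖ := by rw [sub_add_cancel]
    _ ≤ ‖Ψ x y - A y‖ + ‖A y‖ := norm_add_le _ _
    _ ≤ C * (x ^ 2 + ‖y‖ ^ 2) + θ * (C' * x ^ 2) := add_le_add h1 hAy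
    _ ≤ C * (x ^ 2 + x ^ 2) + θ * (C' * x ^ 2) := by gcongr
    _ = C' * x ^ 2 := by linear_combination (-(x ^ 2)) * hC'

include H2 H3 in
/-- Joint Lipschitz bound for the base displacement `N(x, y) = φ x y − x` on the chart:
`|N(x,y) − N(x',y')| ≤ (3bδ₁² + 2Cδ₁³)|x − x'| + Cδ₁³‖y − y'‖`. [folklore] -/
theorem base_lipschitz (hb : 0 < b) (hC : 0 < C) {δ₁ x x' : ℝ} {y y' : E} (hδ₁δ : δ₁ ≤ δ)
    (hx0 : 0 ≤ x) (hx : x ≤ δ₁) (hx0' : 0 ≤ x') (hx' : x' ≤ δ₁) (hy : ‖y‖ ≤ δ₁)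
    (hy' : ‖y'‖ ≤ δ₁) :
    |(φ x y - x) - (φ x' y' - x')| ≤
      (3 * b * δ₁ ^ 2 + 2 * C * δ₁ ^ 3) * |x - x'| + C * δ₁ ^ 3 * ‖y - y'‖ := by
  have hxδ : |x| ≤ δ := by rw [abs_of_nonneg hx0]; exact hx.trans hδ₁δ
  have hxδ' : |x'| ≤ δ := by rw [abs_of_nonneg hx0']; exact hx'.trans hδ₁δ
  have hyδ : ‖y‖ ≤ δ := hy.trans hδ₁δ
  have hyδ' : ‖y'‖ ≤ δ := hy'.trans hδ₁δ
  have h3 := (H3 x x' y hxδ hxδ' hyδ).1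
  have h2 := (H2 x' y y' hxδ' hyδ hyδ').1
  have hfac := base_factor_le (y := y) hC.le hx0 hx hx0' hx' hy
  have hcube := abs_cube_sub_cube_le hx0 hx hx0' hx'
  have hδ₁0 : 0 ≤ δ₁ := hx0.trans hx
  have hx'3 : C * |x'| ^ 3 * ‖y - y'‖ ≤ C * δ₁ ^ 3 * ‖y - y'‖ := by
    rw [abs_of_nonneg hx0']
    exact mul_le_mul_of_nonneg_right
      (mul_le_mul_of_nonneg_left (pow_le_pow_left₀ hx0' hx' 3) hC.le) (norm_nonneg _)
  have e : (φ x y - x) - (φ x' y' - x') =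
      (φ x y - φ x' y - (x - x') - b * (x ^ 3 - x' ^ 3)) + b * (x ^ 3 - x' ^ 3) +
        (φ x' y - φ x' y') := by ring
  rw [e]
  calc |(φ x y - φ x' y - (x - x') - b * (x ^ 3 - x' ^ 3)) + b * (x ^ 3 - x' ^ 3) +
          (φ x' y - φ x' y')|
        ≤ |φ x y - φ x' y - (x - x') - b * (x ^ 3 - x' ^ 3)| + |b * (x ^ 3 - x' ^ 3)| +
          |φ x' y - φ x' y'| := abs_add_three _ _ _
    _ ≤ C * (max |x| |x'|) ^ 2 * (max |x| |x'| + ‖y‖) * |x - x'| + b * (3 * δ₁ ^ 2 * |x - x'|) +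
          C * δ₁ ^ 3 * ‖y - y'‖ := by
        refine add_le_add (add_le_add h3 ?_) (h2.trans hx'3)
        rw [abs_mul, abs_of_pos hb]
        exact mul_le_mul_of_nonneg_left hcube hb.le
    _ ≤ 2 * C * δ₁ ^ 3 * |x - x'| + b * (3 * δ₁ ^ 2 * |x - x'|) + C * δ₁ ^ 3 * ‖y - y'‖ := by
        have := mul_le_mul_of_nonneg_right hfac (abs_nonneg (x - x'))
        linarith
    _ = (3 * b * δ₁ ^ 2 + 2 * C * δ₁ ^ 3) * |x - x'| + C * δ₁ ^ 3 * ‖y - y'‖ := by ring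

include H2 H3 in
/-- Joint Lipschitz bound for the fibre map on the chart:
`‖Ψ x y − Ψ x' y'‖ ≤ 3Cδ₁|x − x'| + (θ + 3Cδ₁)‖y − y'‖`. [folklore] -/
theorem fibre_lipschitz (hC : 0 < C) (hA : ‖A‖ ≤ θ) {δ₁ x x' : ℝ} {y y' : E} (hδ₁δ : δ₁ ≤ δ)
    (hx0 : 0 ≤ x) (hx : x ≤ δ₁) (hx0' : 0 ≤ x') (hx' : x' ≤ δ₁) (hy : ‖y‖ ≤ δ₁)
    (hy' : ‖y'‖ ≤ δ₁) :
    ‖Ψ x y - Ψ x' y'‖ ≤ 3 * C * δ₁ * |x - x'| + (θ + 3 * C * δ₁) * ‖y - y'‖ := by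
  have hxδ : |x| ≤ δ := by rw [abs_of_nonneg hx0]; exact hx.trans hδ₁δ
  have hxδ' : |x'| ≤ δ := by rw [abs_of_nonneg hx0']; exact hx'.trans hδ₁δ
  have hyδ : ‖y‖ ≤ δ := hy.trans hδ₁δ
  have hyδ' : ‖y'‖ ≤ δ := hy'.trans hδ₁δ
  have h3 := (H3 x x' y hxδ hxδ' hyδ).2
  have h2 := (H2 x' y y' hxδ' hyδ hyδ').2
  rw [abs_of_nonneg hx0, abs_of_nonneg hx0'] at h3
  rw [abs_of_nonneg hx0'] at h2
  have hA' : ‖A (y - y')‖ ≤ θ * ‖y - y'‖ :=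
    (A.le_opNorm _).trans (mul_le_mul_of_nonneg_right hA (norm_nonneg _))
  have e : Ψ x y - Ψ x' y' =
      (Ψ x y - Ψ x' y) + (Ψ x' y - Ψ x' y' - A (y - y')) + A (y - y') := by abel
  rw [e]
  calc ‖(Ψ x y - Ψ x' y) + (Ψ x' y - Ψ x' y' - A (y - y')) + A (y - y')‖
        ≤ ‖Ψ x y - Ψ x' y‖ + ‖Ψ x' y - Ψ x' y' - A (y - y')‖ + ‖A (y - y')‖ := norm_add₃_le
    _ ≤ C * (x + x' + ‖y‖) * |x - x'| + C * (x' + ‖y‖ + ‖y'‖) * ‖y - y'‖ + θ * ‖y - y'‖ :=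
        add_le_add (add_le_add h3 h2) hA'
    _ ≤ C * (δ₁ + δ₁ + δ₁) * |x - x'| + C * (δ₁ + δ₁ + δ₁) * ‖y - y'‖ + θ * ‖y - y'‖ := by
        gcongr
    _ = 3 * C * δ₁ * |x - x'| + (θ + 3 * C * δ₁) * ‖y - y'‖ := by ring

include H2 H3 in
/-- Along an `L`-Lipschitz graph (`L ≤ 1`) staying in the chart, the base map `g ↦ φ g (h g)` is
strictly increasing on `[0, δ₁]` as soon as `3 C δ₁³ < 1`. [folklore] -/
theorem strictMonoOn_base (hb : 0 < b) (hC : 0 < C) {δ₁ L : ℝ} {h : ℝ → E} (hδ₁δ : δ₁ ≤ δ)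
    (hK : 3 * C * δ₁ ^ 3 < 1) (hL1 : L ≤ 1) (hlip : ∀ t t', ‖h t - h t'‖ ≤ L * |t - t'|)
    (hbd : ∀ s ∈ Icc (0 : ℝ) δ₁, ‖h s‖ ≤ δ₁) :
    StrictMonoOn (fun g => φ g (h g)) (Icc 0 δ₁) := by
  intro x' hx' x hx hlt
  have hxδ : |x| ≤ δ := by rw [abs_of_nonneg hx.1]; exact hx.2.trans hδ₁δ
  have hxδ' : |x'| ≤ δ := by rw [abs_of_nonneg hx'.1]; exact hx'.2.trans hδ₁δ
  have hyδ : ‖h x‖ ≤ δ := (hbd x hx).trans hδ₁δ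
  have hyδ' : ‖h x'‖ ≤ δ := (hbd x' hx').trans hδ₁δ
  have h3 := (H3 x x' (h x) hxδ hxδ' hyδ).1
  have h2 := (H2 x' (h x) (h x') hxδ' hyδ hyδ').1
  have hfac := base_factor_le (y := h x) hC.le hx.1 hx.2 hx'.1 hx'.2 (hbd x hx)
  have hcube : 0 ≤ b * (x ^ 3 - x' ^ 3) :=
    mul_nonneg hb.le (sub_nonneg.2 (pow_le_pow_left₀ hx'.1 hlt.le 3))
  have hxx' : 0 < x - x' := sub_pos.2 hlt
  rw [abs_of_pos hxx'] at h3
  have hA1 : (1 - 2 * C * δ₁ ^ 3) * (x - x') ≤ φ x (h x) - φ x' (h x) := by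
    have hh := abs_le.1 h3
    nlinarith [mul_le_mul_of_nonneg_right hfac hxx'.le, hh.1]
  have hA2 : |φ x' (h x) - φ x' (h x')| ≤ C * δ₁ ^ 3 * (x - x') := by
    have hδ₁0 : 0 ≤ δ₁ := hx.1.trans hx.2
    calc |φ x' (h x) - φ x' (h x')| ≤ C * |x'| ^ 3 * ‖h x - h x'‖ := h2
      _ ≤ C * δ₁ ^ 3 * (L * |x - x'|) := by
          rw [abs_of_nonneg hx'.1]
          exact mul_le_mul (mul_le_mul_of_nonneg_left (pow_le_pow_left₀ hx'.1 hx'.2 3) hC.le)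
            (hlip x x') (norm_nonneg _) (by positivity)
      _ ≤ C * δ₁ ^ 3 * (1 * |x - x'|) := by gcongr
      _ = C * δ₁ ^ 3 * (x - x') := by rw [one_mul, abs_of_pos hxx']
  have hh2 := abs_le.1 hA2
  show φ x' (h x') < φ x (h x)
  nlinarith [hh2.1, hh2.2, hA1, mul_pos (sub_pos.2 hK) hxx']

include H2 in
/-- **One step contracts towards a forward-invariant Lipschitz graph.** If `h` is `L`-Lipschitz
(`L ≤ 1`), lies in the wedge `‖h s‖ ≤ C' s²` (`C' δ₁ ≤ 1`) and is forward invariant at `g`, then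
`‖Ψ g y − h (φ g y)‖ ≤ (θ + 3Cδ₁ + Cδ₁³) ‖y − h g‖` for every `y` in the chart. [folklore] -/
theorem step_contract (hC : 0 < C) (hA : ‖A‖ ≤ θ) {δ₁ C' L : ℝ} {h : ℝ → E} (hδ₁δ : δ₁ ≤ δ)
    (hC'0 : 0 ≤ C') (hC'δ₁ : C' * δ₁ ≤ 1) (hL1 : L ≤ 1)
    (hlip : ∀ t t', ‖h t - h t'‖ ≤ L * |t - t'|)
    (hbd : ∀ s ∈ Icc (0 : ℝ) δ₁, ‖h s‖ ≤ C' * s ^ 2)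
    {g : ℝ} {y : E} (hg : g ∈ Icc (0 : ℝ) δ₁) (hy : ‖y‖ ≤ δ₁)
    (hinv : Ψ g (h g) = h (φ g (h g))) :
    ‖Ψ g y - h (φ g y)‖ ≤ (θ + 3 * C * δ₁ + C * δ₁ ^ 3) * ‖y - h g‖ := by
  have hC'g : C' * g ≤ 1 := (mul_le_mul_of_nonneg_left hg.2 hC'0).trans hC'δ₁
  have hhg : ‖h g‖ ≤ δ₁ := by
    calc ‖h g‖ ≤ C' * g ^ 2 := hbd g hg
      _ = C' * g * g := by ring
      _ ≤ 1 * g := mul_le_mul_of_nonneg_right hC'g hg.1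
      _ = g := one_mul g
      _ ≤ δ₁ := hg.2
  have hgδ : |g| ≤ δ := by rw [abs_of_nonneg hg.1]; exact hg.2.trans hδ₁δ
  have h2 := (H2 g y (h g) hgδ (hy.trans hδ₁δ) (hhg.trans hδ₁δ)).2
  have h2' := (H2 g (h g) y hgδ (hhg.trans hδ₁δ) (hy.trans hδ₁δ)).1
  rw [abs_of_nonneg hg.1] at h2 h2'
  rw [norm_sub_rev (h g) y] at h2'
  have hA' : ‖A (y - h g)‖ ≤ θ * ‖y - h g‖ :=
    (A.le_opNorm _).trans (mul_le_mul_of_nonneg_right hA (norm_nonneg _))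
  have hδ₁0 : 0 ≤ δ₁ := hg.1.trans hg.2
  have e : Ψ g y - h (φ g y) =
      (Ψ g y - Ψ g (h g) - A (y - h g)) + A (y - h g) + (h (φ g (h g)) - h (φ g y)) := by
    rw [← hinv]; abel
  rw [e]
  calc ‖(Ψ g y - Ψ g (h g) - A (y - h g)) + A (y - h g) + (h (φ g (h g)) - h (φ g y))‖
        ≤ ‖Ψ g y - Ψ g (h g) - A (y - h g)‖ + ‖A (y - h g)‖ + ‖h (φ g (h g)) - h (φ g y)‖ :=
          norm_add₃_le
    _ ≤ C * (g + ‖y‖ + ‖h g‖) * ‖y - h g‖ + θ * ‖y - h g‖ + L * |φ g (h g) - φ g y| :=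
          add_le_add (add_le_add h2 hA') (hlip _ _)
    _ ≤ C * (δ₁ + δ₁ + δ₁) * ‖y - h g‖ + θ * ‖y - h g‖ + 1 * (C * δ₁ ^ 3 * ‖y - h g‖) := by
          have hg0 : 0 ≤ g := hg.1
          have hg1 : g ≤ δ₁ := hg.2
          have hlast : L * |φ g (h g) - φ g y| ≤ 1 * (C * δ₁ ^ 3 * ‖y - h g‖) := by
            calc L * |φ g (h g) - φ g y| ≤ 1 * |φ g (h g) - φ g y| := by gcongr
              _ ≤ 1 * (C * g ^ 3 * ‖y - h g‖) := by rw [one_mul, one_mul]; exact h2'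
              _ ≤ 1 * (C * δ₁ ^ 3 * ‖y - h g‖) := by gcongr
          have hfirst : C * (g + ‖y‖ + ‖h g‖) * ‖y - h g‖ ≤ C * (δ₁ + δ₁ + δ₁) * ‖y - h g‖ := by
            gcongr
          linarith
    _ = (θ + 3 * C * δ₁ + C * δ₁ ^ 3) * ‖y - h g‖ := by ring

include H2 H3 in
/-- Along a graph `h'` continuous on `[0, δ']` and staying in the chart, the base map
`t ↦ φ t (h' t)` is continuous on `[0, δ']`. [folklore] -/
theorem continuousOn_base (hb : 0 < b) (hC : 0 < C) {δ' : ℝ} {h' : ℝ → E} (hδ'δ : δ' ≤ δ)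
    (hc : ContinuousOn h' (Icc 0 δ')) (hbd : ∀ g ∈ Icc (0 : ℝ) δ', ‖h' g‖ ≤ δ') :
    ContinuousOn (fun t => φ t (h' t)) (Icc 0 δ') := by
  intro t₀ ht₀
  have key : ∀ t ∈ Icc (0 : ℝ) δ', dist (φ t (h' t)) (φ t₀ (h' t₀)) ≤
      (1 + 3 * b * δ' ^ 2 + 2 * C * δ' ^ 3) * dist t t₀ + C * δ' ^ 3 * dist (h' t) (h' t₀) := by
    intro t ht
    rw [Real.dist_eq, Real.dist_eq, dist_eq_norm]
    have hL := base_lipschitz (H2 := H2) (H3 := H3) hb hC hδ'δ ht.1 ht.2 ht₀.1 ht₀.2 (hbd t ht)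
      (hbd t₀ ht₀)
    have e : φ t (h' t) - φ t₀ (h' t₀) =
        ((φ t (h' t) - t) - (φ t₀ (h' t₀) - t₀)) + (t - t₀) := by ring
    rw [e]
    calc |((φ t (h' t) - t) - (φ t₀ (h' t₀) - t₀)) + (t - t₀)|
          ≤ |(φ t (h' t) - t) - (φ t₀ (h' t₀) - t₀)| + |t - t₀| := abs_add_le _ _
      _ ≤ _ := by linarith
  have h1 : Tendsto (fun t : ℝ => dist t t₀) (𝓝[Icc 0 δ'] t₀) (𝓝 0) :=
    (tendsto_iff_dist_tendsto_zero.1 tendsto_id).mono_left nhdsWithin_le_nhds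
  have h2 : Tendsto (fun t => dist (h' t) (h' t₀)) (𝓝[Icc 0 δ'] t₀) (𝓝 0) :=
    tendsto_iff_dist_tendsto_zero.1 (hc t₀ ht₀)
  have hsum := (h1.const_mul (1 + 3 * b * δ' ^ 2 + 2 * C * δ' ^ 3)).add (h2.const_mul (C * δ' ^ 3))
  rw [mul_zero, mul_zero, add_zero] at hsum
  refine tendsto_iff_dist_tendsto_zero.2 ?_
  exact squeeze_zero' (Eventually.of_forall fun _ => dist_nonneg)
    (eventually_nhdsWithin_of_forall key) hsum

/-! ### Constants -/

/-- A radius `δ₁ > 0` small enough for every estimate of the construction exists. [folklore] -/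
theorem exists_delta1 {η : ℝ} (hb : 0 < b) (hη : 0 < η) (hδ : 0 < δ) :
    ∃ δ₁ : ℝ, 0 < δ₁ ∧ δ₁ ≤ δ ∧ 2 * C * δ₁ ≤ b ∧ 2 * b * δ₁ ^ 2 ≤ 1 ∧ 2 * C * δ₁ ≤ η ∧
      15 * C * δ₁ ≤ η ^ 2 ∧ 15 * b * δ₁ ^ 2 + 15 * C * δ₁ ^ 3 ≤ η := by
  have hev : ∀ (f : ℝ → ℝ) (a : ℝ), Continuous f → f 0 = 0 → 0 < a →
      ∀ᶠ x in 𝓝[>] (0 : ℝ), f x ≤ a := by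
    intro f a hf hf0 ha
    have hft : Tendsto f (𝓝[>] 0) (𝓝 0) := by
      simpa only [hf0] using (hf.tendsto 0).mono_left nhdsWithin_le_nhds
    exact hft.eventually_le_const ha
  have h0 : ∀ᶠ x in 𝓝[>] (0 : ℝ), 0 < x := self_mem_nhdsWithin
  obtain ⟨δ₁, hδ₁0, hδ₁δ, hK2, hK3, hK1, hK7, hK8⟩ :=
    (h0.and ((hev (fun x => x) δ continuous_id rfl hδ).and
      ((hev (fun x => 2 * C * x) b (by fun_prop) (by simp) hb).and
      ((hev (fun x => 2 * b * x ^ 2) 1 (by fun_prop) (by simp) one_pos).and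
      ((hev (fun x => 2 * C * x) η (by fun_prop) (by simp) hη).and
      ((hev (fun x => 15 * C * x) (η ^ 2) (by fun_prop) (by simp) (by positivity)).and
      (hev (fun x => 15 * b * x ^ 2 + 15 * C * x ^ 3) η (by fun_prop) (by simp) hη))))))).exists
  exact ⟨δ₁, hδ₁0, hδ₁δ, hK2, hK3, hK1, hK7, hK8⟩

/-- The constant bookkeeping: with `η = 1 − θ ∈ (0, 1]`, `L = η/2`, `S = 1 + η/4`, `κ = 1 − η/2`,
`u = Cδ₁`, `w = bδ₁²`, `z = Cδ₁³`, the smallness conditions `15u ≤ η²`, `15w + 15z ≤ η` give the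
four self-map / contraction inequalities of the graph transform. [folklore] -/
theorem consts_ineq {η u w z : ℝ} (hη0 : 0 < η) (hη1 : η ≤ 1) (hu : 0 ≤ u) (hw : 0 ≤ w)
    (h7 : 15 * u ≤ η ^ 2) (h8 : 15 * w + 15 * z ≤ η) :
    1 + (3 * w + 3 * z) * (1 + η / 4) ≤ 1 + η / 4 ∧
    (3 * u + ((1 - η) + 3 * u) * (η / 2)) * (1 + η / 4) ≤ η / 2 ∧
    3 * w + 4 * z ≤ 1 - η / 2 ∧
    3 * u + ((1 - η) + 3 * u) * (η / 2 + 1) ≤ 1 - η / 2 := by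
  have hη2 : η ^ 2 ≤ η := by nlinarith
  refine ⟨?_, ?_, ?_, ?_⟩
  · nlinarith [mul_le_mul h8 (show 1 + η / 4 ≤ 5 / 4 by linarith) (by positivity) hη0.le]
  · have e : (3 * u + ((1 - η) + 3 * u) * (η / 2)) * (1 + η / 4) =
        η / 2 - 3 * η ^ 2 / 8 - η ^ 3 / 8 + 3 * u * ((1 + η / 2) * (1 + η / 4)) := by ring
    rw [e]
    have h15 : (1 + η / 2) * (1 + η / 4) ≤ 15 / 8 := by nlinarith
    nlinarith [mul_le_mul_of_nonneg_left h15 (by positivity : (0 : ℝ) ≤ 3 * u), pow_nonneg hη0.le 3]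
  · nlinarith
  · nlinarith [mul_le_mul_of_nonneg_left hη1 hu]

end Summit.QuantumFields.YangMills.Theorems.ParabolicCentreCurve
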